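import Mathlib.Algebra.Order.Chebyshev
import Literature.Analysis.FluidPDE.TorusClassicalH1Balance
import Literature.Analysis.FunctionSpaces.TorusLinearisedNSEnergy
import HarnessLib

/-!
# The `H¹` balance of the linearised Navier–Stokes equation along a smooth field on the torus

Analysis/FluidPDE proof file (theorems only; no definitions, no named facts), the LINEAR twin of
`TorusClassicalH1Balance` and the `H¹` sequel of `FunctionSpaces/TorusLinearisedNSEnergy`. For a
jointly smooth solution `(w, q)` of the linearised Navier–Stokes equation
`∂ₜw + (u·∇)w + (w·∇)u = νΔw − ∇q`, `div w = 0`, along a jointly smooth field `u` on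
`[a, b] × T^d` (Constantin–Foias 1988, Ch. 14, (14.3)–(14.4); Temam 1997, Ch. VI §3.1,
(3.7)–(3.10); clauses as separate hypotheses, no predicate), the squared gradient norm
`½‖∇w(t)‖₂²` (`Torus.gradNormSq`) has the one-sided derivative

`d/dt ½‖∇w‖₂² = −ν ‖Δw‖₂² + ∫ ⟪(u·∇)w + (w·∇)u, Δw⟫`

within `[a, b]` (`Torus.linearisedNS_hasDerivWithinAt_half_gradNormSq`): pair the equation with
`−Δw` — `∑ᵢ ∫ ⟪∂ᵢ∂ₜw, ∂ᵢw⟫ = −∫ ⟪∂ₜw, Δw⟫` (`∂ₜ∂ᵢ = ∂ᵢ∂ₜ`,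
`Torus.timeDerivWithin_partialDeriv_comm`; Green,
`Torus.sum_integral_inner_partialDeriv_eq_neg_integral_inner_laplacian`), the pressure dropping
out because `Δw` is divergence free (`Torus.IsDivFree.laplacian_of_isSmooth`). This is the
enstrophy-type identity "take the inner product of the (linearised) equation with `AU`" behind
every `H¹` estimate of the first variation equation (Foias–Manley–Rosa–Temam 2001, App. II.A,
(A.55), for the nonlinear system; Constantin–Foias 1988, Prop. 13.2 / Ch. 14 for `S'(t, u₀)`).

For `ν > 0` the production terms are absorbed by Young's inequality
(`Torus.linearisedNS_half_gradNormSq_flux_le`):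
`−ν‖Δw‖₂² + ∫ ⟪F, Δw⟫ ≤ (4ν)⁻¹ ∫ ‖F‖²`, and
`∫ ‖(u·∇)w + (w·∇)u‖² ≤ 2 |d| M² ‖∇w‖₂² + 2 (∑ᵢ Cᵢ)² ∫ ‖w‖²` for bounds `‖u‖ ≤ M`,
`‖∂ᵢu‖ ≤ Cᵢ` on `[a, b] × T^d` (`Torus.integral_norm_sq_convect_le_of_norm_le`,
`Torus.integral_norm_sq_convect_le_of_partialDeriv_le`). Together with the `L²` balance of
`TorusLinearisedNSEnergy` this gives the **exponential `H¹` bound**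
(`Torus.linearisedNS_h1_le_mul_exp`):

`∫ ‖w(t)‖² + ‖∇w(t)‖₂² ≤ (∫ ‖w(a)‖² + ‖∇w(a)‖₂²) · exp(K'(t − a))`,
`K' = 2∑ᵢ Cᵢ + ((∑ᵢ Cᵢ)² + |d| M²)/ν`,

on `[a, b]` (Grönwall for `E + ‖∇w‖₂²`), i.e. the linearised solution operator is exponentially
bounded on `H¹` as well, with a rate depending on `u` only through `sup ‖u‖` and `sup ‖∂ᵢu‖`.
Parabolic smoothing (`H → V` bounds of the cocycle) and backward uniqueness are NOT treated here.

## References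

* C. Foias, O. Manley, R. Rosa, R. Temam, *Navier–Stokes Equations and Turbulence*, CUP 2001,
  App. II.A, (A.55). [`FoiasManleyRosaTemam2001`]
* P. Constantin, C. Foias, *Navier–Stokes Equations*, Chicago Lectures in Math. (1988), Ch. 14,
  (14.2)–(14.6), and Prop. 13.2. [`ConstantinFoiasNSE1988`]
* R. Temam, *Infinite-Dimensional Dynamical Systems in Mechanics and Physics*, 2nd ed. (1997),
  Ch. VI §3.1, (3.7)–(3.11). [`Temam1997`]
-/

noncomputable section

open MeasureTheory Set Filter Function
open scoped ContDiff InnerProductSpace RealInnerProductSpace Topology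

namespace Literature.Analysis.FluidPDE

open Literature.Analysis.FunctionSpaces

variable {d : Type*} [Fintype d] [DecidableEq d]

/-! ### Spatial bounds for the production terms -/

/-- **Transport term in `L²`.** For a field `u : T^d → ℝ^d` with `‖u(x)‖ ≤ M` and a smooth
`w : T^d → F`, `∫ ‖(u·∇)w‖² ≤ |d| M² ‖∇w‖₂²`-type bound:
`∫ ‖(u·∇)w‖² ≤ (Fintype.card d) * M ^ 2 * ∫ ∑ᵢ ‖∂ᵢw‖²` (`(u·∇)w = ∑ᵢ uᵢ ∂ᵢw`, `|uᵢ| ≤ ‖u‖ ≤ M`,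
and Cauchy–Schwarz `(∑ᵢ aᵢ)² ≤ |d| ∑ᵢ aᵢ²`, Mathlib `sq_sum_le_card_mul_sum_sq`). [folklore] -/
theorem Torus.integral_norm_sq_convect_le_of_norm_le
    {u : UnitAddTorus d → EuclideanSpace ℝ d} {w : UnitAddTorus d → EuclideanSpace ℝ d}
    (hw : Torus.IsSmooth w) {M : ℝ} (hM : ∀ x, ‖u x‖ ≤ M) :
    ∫ x, ‖Torus.convect u w x‖ ^ 2 ≤ (Fintype.card d) * M ^ 2 * Torus.gradNormSq w := by
  have hM0 : 0 ≤ M := (norm_nonneg _).trans (hM 0)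
  have hpt : ∀ x, ‖Torus.convect u w x‖ ^ 2 ≤
      (Fintype.card d) * M ^ 2 * ∑ i, ‖Torus.partialDeriv i w x‖ ^ 2 := by
    intro x
    have hconv : Torus.convect u w x = ∑ i, u x i • Torus.partialDeriv i w x :=
      Torus.fderiv_apply_eq_sum_partialDeriv (hw.isContDiff (by simp)) x (u x)
    have hnorm : ‖Torus.convect u w x‖ ≤ M * ∑ i, ‖Torus.partialDeriv i w x‖ := by
      rw [hconv, Finset.mul_sum]
      refine (norm_sum_le _ _).trans (Finset.sum_le_sum fun i _ => ?_)
      rw [norm_smul]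
      exact mul_le_mul ((PiLp.norm_apply_le (u x) i).trans (hM x)) le_rfl (norm_nonneg _) hM0
    have hS0 : 0 ≤ ∑ i, ‖Torus.partialDeriv i w x‖ := Finset.sum_nonneg fun i _ => norm_nonneg _
    have hCS : (∑ i, ‖Torus.partialDeriv i w x‖) ^ 2 ≤
        (Fintype.card d) * ∑ i, ‖Torus.partialDeriv i w x‖ ^ 2 := by
      have h := sq_sum_le_card_mul_sum_sq (s := Finset.univ) (f := fun i => ‖Torus.partialDeriv i w x‖)
      simpa using h
    calc ‖Torus.convect u w x‖ ^ 2 ≤ (M * ∑ i, ‖Torus.partialDeriv i w x‖) ^ 2 :=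
          pow_le_pow_left₀ (norm_nonneg _) hnorm 2
      _ = M ^ 2 * (∑ i, ‖Torus.partialDeriv i w x‖) ^ 2 := by ring
      _ ≤ M ^ 2 * ((Fintype.card d) * ∑ i, ‖Torus.partialDeriv i w x‖ ^ 2) :=
          mul_le_mul_of_nonneg_left hCS (sq_nonneg M)
      _ = (Fintype.card d) * M ^ 2 * ∑ i, ‖Torus.partialDeriv i w x‖ ^ 2 := by ring
  rw [Torus.gradNormSq, ← integral_const_mul]
  exact integral_mono_of_nonneg (Eventually.of_forall fun x => sq_nonneg _)
    ((integrable_finsetSum _ fun i _ => (hw.partialDeriv i).norm_sq.integrable).const_mul _)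
    (Eventually.of_forall hpt)

/-- **Production term in `L²`.** For a `C¹` field `u : T^d → ℝ^d` with `‖∂ᵢu(x)‖ ≤ Cᵢ` and a
smooth `w : T^d → ℝ^d`, `‖(w·∇)u(x)‖ ≤ (∑ᵢ Cᵢ)‖w(x)‖` pointwise, hence
`∫ ‖(w·∇)u‖² ≤ (∑ᵢ Cᵢ)² ∫ ‖w‖²`. [folklore] -/
theorem Torus.integral_norm_sq_convect_le_of_partialDeriv_le
    {u w : UnitAddTorus d → EuclideanSpace ℝ d} (hu : Torus.IsSmooth u) (hw : Torus.IsSmooth w)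
    {C : d → ℝ} (hC : ∀ i x, ‖Torus.partialDeriv i u x‖ ≤ C i) :
    ∫ x, ‖Torus.convect w u x‖ ^ 2 ≤ (∑ i, C i) ^ 2 * ∫ x, ‖w x‖ ^ 2 := by
  set L : ℝ := ∑ i, C i with hL_def
  have hpt : ∀ x, ‖Torus.convect w u x‖ ^ 2 ≤ L ^ 2 * ‖w x‖ ^ 2 := by
    intro x
    have hconv : Torus.convect w u x = ∑ i, w x i • Torus.partialDeriv i u x :=
      Torus.fderiv_apply_eq_sum_partialDeriv (hu.isContDiff (by simp)) x (w x)
    have hnorm : ‖Torus.convect w u x‖ ≤ L * ‖w x‖ := by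
      rw [hconv, hL_def, Finset.sum_mul]
      refine (norm_sum_le _ _).trans (Finset.sum_le_sum fun i _ => ?_)
      rw [norm_smul]
      calc ‖w x i‖ * ‖Torus.partialDeriv i u x‖ ≤ ‖w x‖ * C i :=
            mul_le_mul (PiLp.norm_apply_le (w x) i) (hC i x) (norm_nonneg _) (norm_nonneg _)
        _ = C i * ‖w x‖ := mul_comm _ _
    calc ‖Torus.convect w u x‖ ^ 2 ≤ (L * ‖w x‖) ^ 2 := pow_le_pow_left₀ (norm_nonneg _) hnorm 2
      _ = L ^ 2 * ‖w x‖ ^ 2 := by ring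
  rw [← integral_const_mul]
  exact integral_mono_of_nonneg (Eventually.of_forall fun x => sq_nonneg _)
    ((hw.norm_sq.integrable).const_mul _) (Eventually.of_forall hpt)

omit [DecidableEq d] in
/-- **Young's inequality for the viscous absorption.** For `ν > 0` and smooth fields `F, L` on the
torus, `−ν ∫ ‖L‖² + ∫ ⟪F, L⟫ ≤ (4ν)⁻¹ ∫ ‖F‖²` (pointwise
`⟪F, L⟫ ≤ ‖F‖‖L‖ ≤ ν‖L‖² + ‖F‖²/(4ν)`). [folklore] -/
theorem Torus.neg_mul_integral_norm_sq_add_integral_inner_le {ν : ℝ} (hν : 0 < ν)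
    {F L : UnitAddTorus d → EuclideanSpace ℝ d} (hF : Torus.IsSmooth F) (hL : Torus.IsSmooth L) :
    -ν * (∫ x, ‖L x‖ ^ 2) + ∫ x, ⟪F x, L x⟫ ≤ (4 * ν)⁻¹ * ∫ x, ‖F x‖ ^ 2 := by
  have hpt : ∀ x, ⟪F x, L x⟫ ≤ ν * ‖L x‖ ^ 2 + (4 * ν)⁻¹ * ‖F x‖ ^ 2 := by
    intro x
    have h1 : ⟪F x, L x⟫ ≤ ‖F x‖ * ‖L x‖ := real_inner_le_norm _ _
    have hν4 : 0 < 4 * ν := by positivity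
    -- `ab ≤ ν b² + a²/(4ν)` from `(a - 2ν b)² ≥ 0`
    have h2 : ‖F x‖ * ‖L x‖ ≤ ν * ‖L x‖ ^ 2 + (4 * ν)⁻¹ * ‖F x‖ ^ 2 := by
      rw [← sub_nonneg]
      have key : ν * ‖L x‖ ^ 2 + (4 * ν)⁻¹ * ‖F x‖ ^ 2 - ‖F x‖ * ‖L x‖ =
          (4 * ν)⁻¹ * (‖F x‖ - 2 * ν * ‖L x‖) ^ 2 := by
        field_simp
        ring
      rw [key]
      positivity
    exact h1.trans h2
  have iFL : Integrable (fun x => ⟪F x, L x⟫) volume := (hF.inner hL).integrable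
  have iL : Integrable (fun x => ν * ‖L x‖ ^ 2) volume := (hL.norm_sq.integrable).const_mul ν
  have iF : Integrable (fun x => (4 * ν)⁻¹ * ‖F x‖ ^ 2) volume :=
    (hF.norm_sq.integrable).const_mul _
  have hint : ∫ x, ⟪F x, L x⟫ ≤ ∫ x, (ν * ‖L x‖ ^ 2 + (4 * ν)⁻¹ * ‖F x‖ ^ 2) :=
    integral_mono iFL (iL.add iF) hpt
  rw [integral_add iL iF, integral_const_mul, integral_const_mul] at hint
  linarith

/-! ### The `H¹` balance of the linearised equation -/

/-- **The `H¹` balance of the linearised Navier–Stokes equation on the torus.** Let `u` be jointly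
smooth on `[a, b] × T^d` (`a < b`) and let `(w, q)` be jointly smooth with `div w(t) = 0` and
`∂ₜw + (u·∇)w + (w·∇)u = νΔw − ∇q` pointwise on `[a, b] × T^d` (one-sided time derivative within
`[a, b]`). Then for every `t ∈ [a, b]`,
`d/dt ½‖∇w(t)‖₂² = −ν (∫ ‖Δw(t)‖²) + ∫ ⟪(u·∇)w(t) + (w·∇)u(t), Δw(t)⟫`
as a one-sided derivative within `[a, b]` — "the inner product of the equation with `AU`"
(Foias–Manley–Rosa–Temam 2001, App. II.A, (A.55), written for the nonlinear system; the same
computation for the first variation equation (14.3) of Constantin–Foias 1988): differentiate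
`½ ∫ ∑ᵢ ‖∂ᵢw‖²` under the integral, `∂ₜ‖∂ᵢw‖² = 2⟪∂ᵢ∂ₜw, ∂ᵢw⟫` with `∂ₜ∂ᵢ = ∂ᵢ∂ₜ`
(`Torus.timeDerivWithin_partialDeriv_comm`), Green
(`Torus.sum_integral_inner_partialDeriv_eq_neg_integral_inner_laplacian`), insert the equation,
and drop `∫ ⟪∇q, Δw⟫ = 0` (`Torus.IsDivFree.laplacian_of_isSmooth`,
`Torus.integral_inner_gradient_eq_zero_of_isDivFree`). Incompressibility of `u` is not needed.
[cite: FoiasManleyRosaTemam2001, App. II.A (A.55)] -/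
theorem Torus.linearisedNS_hasDerivWithinAt_half_gradNormSq
    {a b ν : ℝ} {u w : ℝ → UnitAddTorus d → EuclideanSpace ℝ d} {q : ℝ → UnitAddTorus d → ℝ}
    (hu : Torus.IsSmoothSpaceTimeOn (Icc a b) u) (hw : Torus.IsSmoothSpaceTimeOn (Icc a b) w)
    (hq : Torus.IsSmoothSpaceTimeOn (Icc a b) q) (hwdiv : ∀ t ∈ Icc a b, Torus.IsDivFree (w t))
    (hlin : ∀ t ∈ Icc a b, ∀ x, Torus.timeDerivWithin (Icc a b) w t x +
      Torus.convect (u t) (w t) x + Torus.convect (w t) (u t) x =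
        ν • Torus.laplacian (w t) x - Torus.gradient (q t) x)
    (hab : a < b) {t : ℝ} (ht : t ∈ Icc a b) :
    HasDerivWithinAt (fun s => 2⁻¹ * Torus.gradNormSq (w s))
      (-ν * (∫ x, ‖Torus.laplacian (w t) x‖ ^ 2) +
        ∫ x, ⟪Torus.convect (u t) (w t) x + Torus.convect (w t) (u t) x,
          Torus.laplacian (w t) x⟫) (Icc a b) t := by
  set S : Set ℝ := Icc a b with hSdef
  have hSc : Convex ℝ S := convex_Icc a b
  have hU : UniqueDiffOn ℝ S := uniqueDiffOn_Icc hab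
  have hwt : Torus.IsSmooth (w t) := hw.isSmooth_slice ht
  have hut : Torus.IsSmooth (u t) := hu.isSmooth_slice ht
  have hqt : Torus.IsSmooth (q t) := hq.isSmooth_slice ht
  have hA : Torus.IsSmooth (Torus.timeDerivWithin S w t) := hw.isSmooth_timeDerivWithin hU ht
  have hΔ : Torus.IsSmooth (Torus.laplacian (w t)) := hwt.laplacian
  have hDi : ∀ i, Torus.IsSmoothSpaceTimeOn S (fun s => Torus.partialDeriv i (w s)) :=
    fun i => hw.partialDeriv hU i
  -- Step 1: differentiate `½ ∫ ∑ᵢ ‖∂ᵢw‖²` under the integral sign.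
  have hφ : Torus.IsSmoothSpaceTimeOn S (fun s x => ∑ i, ‖Torus.partialDeriv i (w s) x‖ ^ 2) := by
    change ContDiffOn ℝ ∞
      (fun z => ∑ i, ‖Torus.stLift (fun s => Torus.partialDeriv i (w s)) z‖ ^ 2) (S ×ˢ univ)
    exact ContDiffOn.sum fun i _ => (hDi i).norm_sq ℝ
  have hE : HasDerivWithinAt (fun s => 2⁻¹ * Torus.gradNormSq (w s))
      (2⁻¹ * ∫ x, Torus.timeDerivWithin S
        (fun s x => ∑ i, ‖Torus.partialDeriv i (w s) x‖ ^ 2) t x) S t :=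
    (hφ.hasDerivWithinAt_integral hSc ht).const_mul 2⁻¹
  -- Step 2: `∂ₜ ∑ᵢ ‖∂ᵢw‖² = 2 ∑ᵢ ⟪∂ᵢ∂ₜw, ∂ᵢw⟫`.
  have htd : ∀ x, Torus.timeDerivWithin S (fun s x => ∑ i, ‖Torus.partialDeriv i (w s) x‖ ^ 2) t x =
      2 * ∑ i, ⟪Torus.partialDeriv i (Torus.timeDerivWithin S w t) x,
        Torus.partialDeriv i (w t) x⟫ := by
    intro x
    have hsum := HasDerivWithinAt.fun_sum (u := Finset.univ)
      (A := fun i s => ‖Torus.partialDeriv i (w s) x‖ ^ 2)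
      (A' := fun i => 2 * ⟪Torus.partialDeriv i (w t) x,
        Torus.timeDerivWithin S (fun s => Torus.partialDeriv i (w s)) t x⟫) (x := t) (s := S)
      fun i _ => ((hDi i).hasDerivWithinAt_slice ht x).norm_sq
    have h2 := hsum.derivWithin (hU t ht)
    rw [Torus.timeDerivWithin, h2, Finset.mul_sum]
    refine Finset.sum_congr rfl fun i _ => ?_
    rw [Torus.timeDerivWithin_partialDeriv_comm hab hw ht i x, real_inner_comm]
  -- Step 3: Green, `∑ᵢ ∫ ⟪∂ᵢ∂ₜw, ∂ᵢw⟫ = -∫ ⟪∂ₜw, Δw⟫`.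
  have hE' : 2⁻¹ * ∫ x, Torus.timeDerivWithin S
        (fun s x => ∑ i, ‖Torus.partialDeriv i (w s) x‖ ^ 2) t x =
      -∫ x, ⟪Torus.timeDerivWithin S w t x, Torus.laplacian (w t) x⟫ := by
    simp_rw [htd, integral_const_mul]
    rw [integral_finsetSum _ fun i _ => ((hA.partialDeriv i).inner (hwt.partialDeriv i)).integrable,
      Torus.sum_integral_inner_partialDeriv_eq_neg_integral_inner_laplacian hA hwt]
    ring
  rw [hE'] at hE
  convert hE using 1
  -- Step 4: insert the equation; the pressure term drops out.
  have hA_eq : ∀ x, Torus.timeDerivWithin S w t x = ν • Torus.laplacian (w t) x -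
      Torus.gradient (q t) x - (Torus.convect (u t) (w t) x + Torus.convect (w t) (u t) x) := by
    intro x
    rw [← hlin t ht x]
    abel
  have hF : Torus.IsSmooth (fun x => Torus.convect (u t) (w t) x + Torus.convect (w t) (u t) x) :=
    (hut.convect hwt).add (hwt.convect hut)
  have iL : Integrable (fun x => ⟪ν • Torus.laplacian (w t) x, Torus.laplacian (w t) x⟫) volume :=
    ((hΔ.smul ν).inner hΔ).integrable
  have iG : Integrable (fun x => ⟪Torus.gradient (q t) x, Torus.laplacian (w t) x⟫) volume :=
    (hqt.gradient.inner hΔ).integrable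
  have iF : Integrable (fun x => ⟪Torus.convect (u t) (w t) x + Torus.convect (w t) (u t) x,
      Torus.laplacian (w t) x⟫) volume := (hF.inner hΔ).integrable
  have hsplit : ∫ x, ⟪Torus.timeDerivWithin S w t x, Torus.laplacian (w t) x⟫ =
      (∫ x, ⟪ν • Torus.laplacian (w t) x, Torus.laplacian (w t) x⟫) -
        (∫ x, ⟪Torus.gradient (q t) x, Torus.laplacian (w t) x⟫) -
        ∫ x, ⟪Torus.convect (u t) (w t) x + Torus.convect (w t) (u t) x,
          Torus.laplacian (w t) x⟫ := by
    simp_rw [hA_eq, inner_sub_left]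
    rw [integral_sub ?_ iF, integral_sub iL iG]
    exact iL.sub iG
  have hvisc : ∫ x, ⟪ν • Torus.laplacian (w t) x, Torus.laplacian (w t) x⟫ =
      ν * ∫ x, ‖Torus.laplacian (w t) x‖ ^ 2 := by
    rw [← integral_const_mul]
    refine integral_congr_ae (ae_of_all _ fun x => ?_)
    simp only [real_inner_smul_left, real_inner_self_eq_norm_sq]
  have hpres : ∫ x, ⟪Torus.gradient (q t) x, Torus.laplacian (w t) x⟫ = 0 :=
    Torus.integral_inner_gradient_eq_zero_of_isDivFree hΔ hqt
      (Torus.IsDivFree.laplacian_of_isSmooth hwt (hwdiv t ht))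
  rw [hsplit, hvisc, hpres]
  ring

/-- **The `H¹` flux of the linearised equation is controlled by the `H¹` energy** (`ν > 0`). For
smooth `v, w : T^d → ℝ^d` with `‖v‖ ≤ M`, `‖∂ᵢv‖ ≤ Cᵢ` on `T^d`,
`−ν ∫ ‖Δw‖² + ∫ ⟪(v·∇)w + (w·∇)v, Δw⟫ ≤ (2ν)⁻¹ (|d| M² ‖∇w‖₂² + (∑ᵢ Cᵢ)² ∫ ‖w‖²)`
(Young, `Torus.neg_mul_integral_norm_sq_add_integral_inner_le`; `‖F + G‖² ≤ 2‖F‖² + 2‖G‖²`;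
`Torus.integral_norm_sq_convect_le_of_norm_le`, `Torus.integral_norm_sq_convect_le_of_partialDeriv_le`).
[folklore] -/
theorem Torus.linearisedNS_half_gradNormSq_flux_le {ν : ℝ} (hν : 0 < ν)
    {v w : UnitAddTorus d → EuclideanSpace ℝ d} (hv : Torus.IsSmooth v) (hw : Torus.IsSmooth w)
    {M : ℝ} (hM : ∀ x, ‖v x‖ ≤ M) {C : d → ℝ} (hC : ∀ i x, ‖Torus.partialDeriv i v x‖ ≤ C i) :
    -ν * (∫ x, ‖Torus.laplacian w x‖ ^ 2) +
        ∫ x, ⟪Torus.convect v w x + Torus.convect w v x, Torus.laplacian w x⟫ ≤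
      (2 * ν)⁻¹ * ((Fintype.card d) * M ^ 2 * Torus.gradNormSq w +
        (∑ i, C i) ^ 2 * ∫ x, ‖w x‖ ^ 2) := by
  have hF1 : Torus.IsSmooth (Torus.convect v w) := hv.convect hw
  have hF2 : Torus.IsSmooth (Torus.convect w v) := hw.convect hv
  have hF : Torus.IsSmooth (fun x => Torus.convect v w x + Torus.convect w v x) := hF1.add hF2
  have hY := Torus.neg_mul_integral_norm_sq_add_integral_inner_le hν hF hw.laplacian
  -- `‖F₁ + F₂‖² ≤ 2‖F₁‖² + 2‖F₂‖²`
  have hsum : ∫ x, ‖Torus.convect v w x + Torus.convect w v x‖ ^ 2 ≤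
      2 * (∫ x, ‖Torus.convect v w x‖ ^ 2) + 2 * ∫ x, ‖Torus.convect w v x‖ ^ 2 := by
    rw [← integral_const_mul, ← integral_const_mul,
      ← integral_add ((hF1.norm_sq.integrable).const_mul 2) ((hF2.norm_sq.integrable).const_mul 2)]
    refine integral_mono_of_nonneg (Eventually.of_forall fun x => sq_nonneg _)
      (((hF1.norm_sq.integrable).const_mul 2).add ((hF2.norm_sq.integrable).const_mul 2))
      (Eventually.of_forall fun x => ?_)
    have h := norm_add_sq_real (Torus.convect v w x) (Torus.convect w v x)
    have hcs := abs_real_inner_le_norm (Torus.convect v w x) (Torus.convect w v x)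
    have hab := (abs_le.1 hcs).2
    nlinarith [sq_nonneg (‖Torus.convect v w x‖ - ‖Torus.convect w v x‖)]
  have h1 := Torus.integral_norm_sq_convect_le_of_norm_le hw hM
  have h2 := Torus.integral_norm_sq_convect_le_of_partialDeriv_le hv hw hC
  have hν2 : 0 < (2 * ν)⁻¹ := by positivity
  have hν4 : (4 * ν)⁻¹ = (2 * ν)⁻¹ * 2⁻¹ := by
    rw [← mul_inv]; congr 1; ring
  calc -ν * (∫ x, ‖Torus.laplacian w x‖ ^ 2) +
        ∫ x, ⟪Torus.convect v w x + Torus.convect w v x, Torus.laplacian w x⟫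
      ≤ (4 * ν)⁻¹ * ∫ x, ‖Torus.convect v w x + Torus.convect w v x‖ ^ 2 := hY
    _ ≤ (4 * ν)⁻¹ * (2 * (∫ x, ‖Torus.convect v w x‖ ^ 2) + 2 * ∫ x, ‖Torus.convect w v x‖ ^ 2) :=
        mul_le_mul_of_nonneg_left hsum (by positivity)
    _ = (2 * ν)⁻¹ * ((∫ x, ‖Torus.convect v w x‖ ^ 2) + ∫ x, ‖Torus.convect w v x‖ ^ 2) := by
        rw [hν4]; ring
    _ ≤ (2 * ν)⁻¹ * ((Fintype.card d) * M ^ 2 * Torus.gradNormSq w +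
        (∑ i, C i) ^ 2 * ∫ x, ‖w x‖ ^ 2) :=
        mul_le_mul_of_nonneg_left (add_le_add h1 h2) hν2.le

/-- **Exponential `H¹` bound for the linearised Navier–Stokes equation (`ν > 0`).** Let `u` be
jointly smooth on `[a, b] × T^d` with divergence-free slices, `‖u‖ ≤ M` and `‖∂ᵢu‖ ≤ Cᵢ` there,
and let `(w, q)` be jointly smooth with `div w(t) = 0` and
`∂ₜw + (u·∇)w + (w·∇)u = νΔw − ∇q` pointwise (one-sided time derivative within `[a, b]`). Then
for all `t ∈ [a, b]`,
`∫ ‖w(t)‖² + ‖∇w(t)‖₂² ≤ (∫ ‖w(a)‖² + ‖∇w(a)‖₂²) · exp(K'(t − a))` with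
`K' = 2∑ᵢ Cᵢ + ((∑ᵢ Cᵢ)² + |d| M²)/ν`:
add the `L²` balance `E' ≤ 2(∑ᵢ Cᵢ) E` (`TorusLinearisedNSEnergy`) and twice the `H¹` balance
with its flux bound, `G' ≤ ν⁻¹(|d| M² G + (∑ᵢ Cᵢ)² E)`, and apply Grönwall to `E + G` (Mathlib
`le_gronwallBound_of_liminf_deriv_right_le`). The solution operator of the first variation
equation is thus exponentially bounded on `H¹` with a rate depending on `u` only through
`sup ‖u‖` and `sup ‖∂ᵢu‖` (Constantin–Foias 1988, Ch. 14: `S'(t, u₀)` bounded `H → V` by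
Prop. 13.2; here the elementary `V → V` part). [folklore] -/
theorem Torus.linearisedNS_h1_le_mul_exp
    {a b ν : ℝ} {u w : ℝ → UnitAddTorus d → EuclideanSpace ℝ d} {q : ℝ → UnitAddTorus d → ℝ}
    (hν : 0 < ν) (hu : Torus.IsSmoothSpaceTimeOn (Icc a b) u)
    (hudiv : ∀ t ∈ Icc a b, Torus.IsDivFree (u t))
    (hw : Torus.IsSmoothSpaceTimeOn (Icc a b) w) (hq : Torus.IsSmoothSpaceTimeOn (Icc a b) q)
    (hwdiv : ∀ t ∈ Icc a b, Torus.IsDivFree (w t))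
    (hlin : ∀ t ∈ Icc a b, ∀ x, Torus.timeDerivWithin (Icc a b) w t x +
      Torus.convect (u t) (w t) x + Torus.convect (w t) (u t) x =
        ν • Torus.laplacian (w t) x - Torus.gradient (q t) x)
    {M : ℝ} (hM : ∀ t ∈ Icc a b, ∀ x, ‖u t x‖ ≤ M)
    {C : d → ℝ} (hC : ∀ i, ∀ t ∈ Icc a b, ∀ x, ‖Torus.partialDeriv i (u t) x‖ ≤ C i)
    {t : ℝ} (ht : t ∈ Icc a b) :
    (∫ x, ‖w t x‖ ^ 2) + Torus.gradNormSq (w t) ≤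
      ((∫ x, ‖w a x‖ ^ 2) + Torus.gradNormSq (w a)) *
        Real.exp ((2 * ∑ i, C i + ((∑ i, C i) ^ 2 + (Fintype.card d) * M ^ 2) / ν) * (t - a)) := by
  rcases lt_or_ge a b with hab | hba
  · have ha : a ∈ Icc a b := ⟨le_rfl, hab.le⟩
    have hL0 : 0 ≤ ∑ i, C i := Finset.sum_nonneg fun i _ => (norm_nonneg _).trans (hC i a ha 0)
    set Y : ℝ → ℝ := fun s => (∫ x, ‖w s x‖ ^ 2) + Torus.gradNormSq (w s) with hY_def
    set Y' : ℝ → ℝ := fun s =>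
      (-(2 * ν * Torus.gradNormSq (w s)) - 2 * ∫ x, ⟪Torus.convect (w s) (u s) x, w s x⟫) +
        2 * (-ν * (∫ x, ‖Torus.laplacian (w s) x‖ ^ 2) +
          ∫ x, ⟪Torus.convect (u s) (w s) x + Torus.convect (w s) (u s) x,
            Torus.laplacian (w s) x⟫) with hY'_def
    have hYd : ∀ s ∈ Icc a b, HasDerivWithinAt Y (Y' s) (Icc a b) s := by
      intro s hs
      have h1 := Torus.linearisedNS_hasDerivWithinAt_integral_norm_sq hu hudiv hw hq hwdiv hlin hab hs
      have h2 := (Torus.linearisedNS_hasDerivWithinAt_half_gradNormSq hu hw hq hwdiv hlin hab hs).const_mul 2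
      have h2' : HasDerivWithinAt (fun r => Torus.gradNormSq (w r))
          (2 * (-ν * (∫ x, ‖Torus.laplacian (w s) x‖ ^ 2) +
            ∫ x, ⟪Torus.convect (u s) (w s) x + Torus.convect (w s) (u s) x,
              Torus.laplacian (w s) x⟫)) (Icc a b) s := by
        refine h2.congr (fun r _ => ?_) ?_ <;> ring
      exact h1.add h2'
    -- `Y' ≤ 2(∑C)·E + ν⁻¹(|d|M² G + (∑C)² E) ≤ K' (E + G)`
    have hY'le : ∀ s ∈ Icc a b,
        Y' s ≤ (2 * ∑ i, C i + ((∑ i, C i) ^ 2 + (Fintype.card d) * M ^ 2) / ν) * Y s := by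
      intro s hs
      have hus := hu.isSmooth_slice hs
      have hws := hw.isSmooth_slice hs
      have hE := Torus.linearisedNS_energy_flux_le hν.le hus hws fun i x => hC i s hs x
      have hG := Torus.linearisedNS_half_gradNormSq_flux_le hν hus hws (hM s hs) fun i x => hC i s hs x
      have hE0 : 0 ≤ ∫ x, ‖w s x‖ ^ 2 := integral_nonneg fun x => sq_nonneg _
      have hG0 : 0 ≤ Torus.gradNormSq (w s) := Torus.gradNormSq_nonneg _
      have hM2 : 0 ≤ (Fintype.card d : ℝ) * M ^ 2 := by positivity
      have hr0 : 0 ≤ ν⁻¹ := inv_nonneg.2 hν.le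
      have hr : (2 * ν)⁻¹ = 2⁻¹ * ν⁻¹ := by rw [mul_inv]
      rw [hr] at hG
      simp only [hY'_def, hY_def, div_eq_mul_inv]
      nlinarith [hE, hG, mul_nonneg (mul_nonneg zero_le_two hL0) hG0,
        mul_nonneg (mul_nonneg hM2 hr0) hE0,
        mul_nonneg (mul_nonneg (sq_nonneg (∑ i, C i)) hr0) hG0]
    have hYc : ContinuousOn Y (Icc a b) := fun s hs => (hYd s hs).continuousWithinAt
    have hder : ∀ s ∈ Ico a b, HasDerivWithinAt Y (Y' s) (Ici s) s := fun s hs =>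
      ((hYd s (Ico_subset_Icc_self hs)).mono (Icc_subset_Icc hs.1 le_rfl)).mono_of_mem_nhdsWithin
        (Icc_mem_nhdsGE hs.2)
    have hgr := le_gronwallBound_of_liminf_deriv_right_le (f := Y) (f' := Y') (δ := Y a)
      (K := 2 * ∑ i, C i + ((∑ i, C i) ^ 2 + (Fintype.card d) * M ^ 2) / ν) (ε := 0) (a := a)
      (b := b) hYc (fun s hs r hr => (hder s hs).liminf_right_slope_le hr) le_rfl
      (fun s hs => by
        rw [add_zero]
        exact hY'le s (Ico_subset_Icc_self hs)) t ht
    rwa [gronwallBound_ε0] at hgr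
  · have hta : t = a := le_antisymm (ht.2.trans hba) ht.1
    rw [hta, sub_self, mul_zero, Real.exp_zero, mul_one]

end Literature.Analysis.FluidPDE

end
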